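import Summits.HodgeConjecture.CorCM.MumfordTateRankThree
import Summits.HodgeConjecture.CorCM.MumfordTateRankThreeCurves
import Summits.HodgeConjecture.CorCM.MumfordTateRankOfCMAbelianVariety
import Summits.HodgeConjecture.CorCM.CMCurvesAndSimpleSurfacesHodge
import Literature.AlgebraicGeometry.Motives.AbelianVarietySimpleOfIsogeny
import Literature.AlgebraicGeometry.Motives.AbelianVarietyProductIsogeny
import HarnessLib

/-!
# Products of CM elliptic curves and at most two simple CM abelian surfaces: `dim MT(H¹X) = rdim X + 1` — the Mumford–Tate rank of
# every `X ∼ ∏ E_i^{a_i} × S^b × S'^{b'}` read off seat p2's closure census (Moonen–Zarhin 1999 §3; Imai; Shimura §8.4 (2))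

COR-CM (cell `pub-hodgecm2`, seat `b27` gen 49, count-neutral Mumford–Tate-rank ladder; theorems only, no definition, no named fact;
UNCONDITIONAL — nothing here uses or asserts HC_CM).  Notation `t(X) = dim MT(H¹X)`, `rdim X = Σ dim` over the isogeny classes of simple factors.

Seat p2's `CMCurvesAndSurfaces.isNondegenerateFamily_curves_simpleSurfaces_of_closures` (`CorCM/CMCurvesAndSimpleSurfacesHodge`): a family of
pairwise non-isogenous CM elliptic curves and simple CM abelian surfaces (realisations of CM types on fields of degree `2` or `4`) is NONDEGENERATE as
soon as no three of the fields share their Galois closure.  Two CURVE slots never share a closure (`normalClosure_ne_of_finrank_eq_two`), so with AT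
MOST TWO surface slots the closure condition is automatic.  This file transports that to ABSTRACT varieties: realise each simple CM factor
(`Pohlmann1968.exists_realisation_mtRank_eq`), carry `X ∼ ⨁_j F_{cls j}` along the isogenies, and read nondegeneracy as `t(X) = Σ_i dim F_i + 1`
(`isNondegenerateFamily_iff_mtRank_hodge_one_eq`, Gordon 9.1 / Deligne I Ex. 3.7 (c)) and as `B• = D•` on all powers
(`forall_isDivisorGenerated_powSucc_iff_mtRank_hodge_one_eq`, Hazama–Murty):

* **`mtRank_hodge_one_eq_and_isDivisorGenerated_of_isIsogenous_biproduct_cmCurves_cmSurfaces`** — for `X ∼ ⨁_j F_{cls j}` (`cls` onto `I`) with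
  `F_i` pairwise non-isogenous, simple, of CM type, of dimensions `1` or `2`, at most two of dimension `2`:
  `t(X) = Σ_i dim F_i + 1` and every power `X^{N+1}` is divisor-generated;
* the all-CM cells of the partitions `{2,1,1}` (dimension `4`) and `{2,2,1}` (dimension `5`):
  `mtRank_hodge_one_eq_five_of_isIsogenous_cmSurface_prod_prod_cmCurves` (`S × E × E'`, `E ≁ E'`: `t = 5`),
  `mtRank_hodge_one_eq_four_of_isIsogenous_cmSurface_prod_prod_cmCurves_of_isIsogenous` (`E ∼ E'`: `t = 4`),
  `mtRank_hodge_one_eq_six_of_isIsogenous_cmSurfaces_prod_prod_cmCurve` (`S × S' × E`, `S ≁ S'`: `t = 6`).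

## References
* [MoonenZarhin1999LowDim] B. Moonen, Yu. G. Zarhin, *Hodge classes on abelian varieties of low dimension*, Math. Ann. 315 (1999), §3 (3.1), (3.4),
  Cor. (3.9) [corpus: paper:arxiv-math_9901113 pp. 6–7]. [cite: MoonenZarhin1999LowDim, §3 (3.1) and (3.9)]
* [Gordon1999HodgeAVSurvey] B. B. Gordon, *A survey of the Hodge conjecture for abelian varieties*, §3 Theorem (Imai, Murty), 7.5–7.7, 9.1.
  [cite: Gordon1999HodgeAVSurvey, 7.5 and 9.1]
* [Shimura1998] G. Shimura, *Abelian Varieties with Complex Multiplication and Modular Functions*, §8.4 Example (2). [cite: Shimura1998, §8.4 Example (2)]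
* [MumfordAV1970] D. Mumford, *Abelian Varieties* (1970), §19 Cor. 1 of Thm. 1. [cite: MumfordAV1970, §19 Cor. 1 of Thm. 1]
-/

noncomputable section

open CategoryTheory CategoryTheory.Limits NumberField Module IntermediateField
open scoped BigOperators

namespace Summit.HodgeConjecture.CorCM

open Literature.NumberTheory.ComplexMultiplication
open Literature.AlgebraicGeometry.Motives
open Literature.AlgebraicGeometry.Motives.AbelianVariety
open Literature.AlgebraicGeometry.HodgeTheory
open Literature.AlgebraicGeometry.ComplexMultiplication
open Literature.AlgebraicGeometry.Milne1999 (IsOfCMType isIsogeny_biproduct_map)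
open Literature.AlgebraicGeometry.Pohlmann1968

variable [HodgeTensorFacts.{0, 0}] {X : AbelianVariety ℂ} {n : ℕ}

/-! ## §1 The general formula: CM curves and at most two simple CM surfaces -/

/-- **`t(X) = Σ_i dim F_i + 1` and all powers divisor-generated**, for `X ∼ ⨁_j F_{cls j}` (`cls` onto `I`) with `F_i` pairwise non-isogenous
SIMPLE abelian varieties of CM type of dimension `1` or `2`, at most two of them surfaces (`Hg(X) = ∏_i Hg(F_i)`, a torus of rank `Σ_i dim F_i`).
Realise each `F_i` as a CM type on a field of degree `2` or `4`; two curve slots have distinct closures, so no three slots share one, and seat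
p2's closure census gives nondegeneracy, i.e. `t = rdim + 1` and `B• = D•` on every power.
[cite: MoonenZarhin1999LowDim, §3 (3.1) and (3.9)] [cite: Gordon1999HodgeAVSurvey, 7.5 and 9.1] [cite: Shimura1998, §8.4 Example (2)] -/
theorem mtRank_hodge_one_eq_and_isDivisorGenerated_of_isIsogenous_biproduct_cmCurves_cmSurfaces {I : Type} [Fintype I] [DecidableEq I]
    {F : I → AbelianVariety ℂ} (hFs : ∀ i, (F i).IsSimple) (hFcm : ∀ i, IsOfCMType (F i)) (hF12 : ∀ i, (F i).dim = 1 ∨ (F i).dim = 2)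
    (hFniso : ∀ i i', i ≠ i' → ¬ IsIsogenous (F i) (F i'))
    (h3 : ∀ i j k : I, i ≠ j → j ≠ k → i ≠ k → (F i).dim = 2 → (F j).dim = 2 → (F k).dim ≠ 2)
    {m : ℕ} {cls : Fin (m + 1) → I} (hcls : Function.Surjective cls) (hX : IsSmoothProjective n X.X)
    (hXP : IsIsogenous X (⨁ fun j => F (cls j))) :
    haveI := BettiUniverse.finite hX 1
    (BettiUniverse.hodge exists_isReal_hodgeModel_holds hX 1).mtRank = ∑ i, (F i).dim + 1 ∧ ∀ N : ℕ, IsDivisorGenerated (X.powSucc N) := by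
  classical
  haveI : Nonempty I := ⟨cls 0⟩
  have h0 : ∀ i, 0 < (F i).dim := fun i => by rcases hF12 i with h | h <;> omega
  -- realisations `F' i ∼ F i` of CM types `Φ i` on CM fields `K i` of degree `2 · dim F_i`
  have hreal := fun i => exists_realisation_mtRank_eq (AbelianVariety.isSmoothProjective_holds (A := F i)) (hFs i) (h0 i) (hFcm i)
  choose K fK nfK cmK Φ F' ι θ s₀ hspec using hreal
  have hA : ∀ i, IsCMTypeRealisation (Φ i) (F' i) (ι i) (θ i) := fun i => (hspec i).1
  have hiso : ∀ i, IsIsogenous (F i) (F' i) := fun i => (hspec i).2.1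
  have hdeg : ∀ i, Module.finrank ℚ (K i) = 2 * (F i).dim := fun i => (hspec i).2.2.1
  have hdim : ∀ i, Module.finrank ℚ (K i) = 2 ∨ Module.finrank ℚ (K i) = 4 := fun i => by
    rcases hF12 i with h | h
    · exact Or.inl (by rw [hdeg i, h])
    · exact Or.inr (by rw [hdeg i, h])
  have hdimF' : ∀ i, (F' i).dim = (F i).dim := fun i => ((dim_eq_of_isIsogenous_holds (hiso i) : (F i).dim = (F' i).dim)).symm
  have hs : ∀ i, (F' i).IsSimple := fun i => (hFs i).of_isIsogenous (hiso i)
  have hniso' : ∀ i i', i ≠ i' → ¬ IsIsogenous (F' i) (F' i') := fun i i' hii' h =>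
    hFniso i i' hii' (((hiso i).trans h).trans (hiso i').symm')
  -- `X ∼ ⨁_j F'_{cls j}`
  choose g hg using fun j => hiso (cls j)
  have hXB : IsIsogenous X (⨁ fun j => F' (cls j)) := hXP.trans ⟨biproduct.map g, isIsogeny_biproduct_map hg⟩
  -- no three slots share a Galois closure: a slot sharing its closure with another one is a surface
  have hsep : CMAlgebra.IsSeparatingFamily Φ := CMAlgebra.isSeparatingFamily_of_isSimple_of_pairwise_not_isIsogenous hA hs hniso'
  have h2of : ∀ {i j : I}, i ≠ j → normalClosure ℚ (K i) ℂ = normalClosure ℚ (K j) ℂ → (F i).dim = 2 := by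
    intro i j hij hL
    rcases hF12 i with h1 | h2
    · exact absurd hL (CMCurvesAndSurfaces.normalClosure_ne_of_finrank_eq_two hdim hsep hij (by rw [hdeg i, h1]))
    · exact h2
  have hcl : ∀ i j k : I, i ≠ j → j ≠ k → i ≠ k → normalClosure ℚ (K i) ℂ = normalClosure ℚ (K j) ℂ →
      normalClosure ℚ (K j) ℂ ≠ normalClosure ℚ (K k) ℂ := fun i j k hij hjk hik hLij hLjk =>
    h3 i j k hij hjk hik (h2of hij hLij) (h2of hjk hLjk) (h2of (Ne.symm hjk) hLjk.symm)
  have hnd : CMAlgebra.IsNondegenerateFamily Φ :=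
    CMCurvesAndSurfaces.isNondegenerateFamily_curves_simpleSurfaces_of_closures hdim hA hs hniso' hcl
  have ht := (isNondegenerateFamily_iff_mtRank_hodge_one_eq hA hcls hX hXB).1 hnd
  have hsum : ∑ i, (F' i).dim = ∑ i, (F i).dim := Finset.sum_congr rfl fun i _ => hdimF' i
  exact ⟨by rw [ht, hsum], (forall_isDivisorGenerated_powSucc_iff_mtRank_hodge_one_eq hA hs hniso' hcls hX hXB).2 ht⟩

/-! ## §2 The all-CM cells `S × E × E'` (partition `{2,1,1}`) and `S × S' × E` (partition `{2,2,1}`) -/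

/-- **Simple CM surface × two NON-isogenous CM elliptic curves: `t(S × E × E') = 5`** (`Hg = U_F × U_k × U_{k'}`, rank `4 = rdim`).
[cite: MoonenZarhin1999LowDim, §3 (3.1) and (3.9)] [cite: Gordon1999HodgeAVSurvey, 7.5 and 9.1] -/
theorem mtRank_hodge_one_eq_five_of_isIsogenous_cmSurface_prod_prod_cmCurves (hX : IsSmoothProjective n X.X) {S E E' : AbelianVariety ℂ}
    (hSs : S.IsSimple) (hS2 : S.dim = 2) (hScm : IsOfCMType S) (hE1 : E.dim = 1) (hEcm : IsOfCMType E) (hE'1 : E'.dim = 1)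
    (hE'cm : IsOfCMType E') (hEE' : ¬ IsIsogenous E E') (hXP : IsIsogenous X (S.prod (E.prod E'))) :
    haveI := BettiUniverse.finite hX 1
    (BettiUniverse.hodge exists_isReal_hodgeModel_holds hX 1).mtRank = 5 ∧ ∀ N : ℕ, IsDivisorGenerated (X.powSucc N) := by
  classical
  let F : Fin 3 → AbelianVariety ℂ := ![S, E, E']
  have hF0 : F 0 = S := rfl
  have hF1 : F 1 = E := rfl
  have hF2 : F 2 = E' := rfl
  have hXB : IsIsogenous X (⨁ fun j => F (id j)) := hXP.trans (biproduct_three_isIsogenous_prod_prod F).symm'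
  have hdimF : ∀ i, (F i).dim = if i = 0 then 2 else 1 := fun i => by
    fin_cases i
    · simpa [hF0] using hS2
    · simpa [hF1] using hE1
    · simpa [hF2] using hE'1
  have hFs : ∀ i, (F i).IsSimple := fun i => by
    fin_cases i
    · exact hSs
    · exact isSimple_of_dim_le_one (A := E) hE1.le
    · exact isSimple_of_dim_le_one (A := E') hE'1.le
  have hFcm : ∀ i, IsOfCMType (F i) := fun i => by
    fin_cases i
    · exact hScm
    · exact hEcm
    · exact hE'cm
  have hF12 : ∀ i, (F i).dim = 1 ∨ (F i).dim = 2 := fun i => by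
    rw [hdimF i]; split_ifs <;> simp
  have hd2 : ∀ i, (F i).dim = 2 → i = 0 := fun i hi => by
    rw [hdimF i] at hi; split_ifs at hi with h
    · exact h
    · omega
  have hFniso : ∀ i i', i ≠ i' → ¬ IsIsogenous (F i) (F i') := by
    intro i i' hii' h
    have hd : (F i).dim = (F i').dim := dim_eq_of_isIsogenous_holds h
    fin_cases i <;> fin_cases i'
    · exact hii' rfl
    · exact absurd hd (by simp [hdimF])
    · exact absurd hd (by simp [hdimF])
    · exact absurd hd (by simp [hdimF])
    · exact hii' rfl
    · exact hEE' h
    · exact absurd hd (by simp [hdimF])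
    · exact hEE' h.symm'
    · exact hii' rfl
  have h3 : ∀ i j k : Fin 3, i ≠ j → j ≠ k → i ≠ k → (F i).dim = 2 → (F j).dim = 2 → (F k).dim ≠ 2 :=
    fun i j k hij _ _ hi hj _ => hij ((hd2 i hi).trans (hd2 j hj).symm)
  have h := mtRank_hodge_one_eq_and_isDivisorGenerated_of_isIsogenous_biproduct_cmCurves_cmSurfaces hFs hFcm hF12 hFniso h3
    Function.surjective_id hX hXB
  have hsum : ∑ i, (F i).dim = 4 := by
    simp only [Fin.sum_univ_three, hdimF]
    decide
  rw [hsum] at h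
  exact h

/-- **Simple CM surface × two ISOGENOUS CM elliptic curves: `t(S × E × E') = t(S × E) = 4`** (the duplicate factor does not change `Hg`).
[cite: MoonenZarhin1999LowDim, §3 (3.1)] [cite: Gordon1999HodgeAVSurvey, 7.5, 7.6.1 and 9.1] -/
theorem mtRank_hodge_one_eq_four_of_isIsogenous_cmSurface_prod_prod_cmCurves_of_isIsogenous (hX : IsSmoothProjective n X.X)
    {S E E' : AbelianVariety ℂ} (hSs : S.IsSimple) (hS2 : S.dim = 2) (hScm : IsOfCMType S) (hE1 : E.dim = 1) (hEcm : IsOfCMType E)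
    (hEE' : IsIsogenous E E') (hXP : IsIsogenous X (S.prod (E.prod E'))) :
    haveI := BettiUniverse.finite hX 1
    (BettiUniverse.hodge exists_isReal_hodgeModel_holds hX 1).mtRank = 4 ∧ ∀ N : ℕ, IsDivisorGenerated (X.powSucc N) := by
  classical
  -- `X ∼ S × (E × E') ∼ S × (E × E) ∼ ⨁ ![S, E, E] = ⨁_j ![S, E] (cls j)`, `cls = ![0, 1, 1]`
  obtain ⟨g, hg⟩ := hEE'.symm'
  have hXP' : IsIsogenous X (S.prod (E.prod E)) :=
    hXP.trans ⟨prodMap (𝟙 S) (prodMap (𝟙 E) g), isIsogeny_prodMap (isIsogeny_id _) (isIsogeny_prodMap (isIsogeny_id _) hg)⟩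
  let F : Fin 2 → AbelianVariety ℂ := ![S, E]
  let cls : Fin 3 → Fin 2 := ![0, 1, 1]
  have hFc : (fun j => F (cls j)) = ![S, E, E] := funext fun j => by fin_cases j <;> rfl
  have hXB : IsIsogenous X (⨁ fun j => F (cls j)) := by
    rw [hFc]
    exact hXP'.trans (biproduct_three_isIsogenous_prod_prod ![S, E, E]).symm'
  have hcls : Function.Surjective cls := fun i => by
    fin_cases i
    · exact ⟨0, rfl⟩
    · exact ⟨1, rfl⟩
  have hF0 : F 0 = S := rfl
  have hF1 : F 1 = E := rfl
  have hdimF : ∀ i, (F i).dim = if i = 0 then 2 else 1 := fun i => by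
    fin_cases i
    · simpa [hF0] using hS2
    · simpa [hF1] using hE1
  have hFs : ∀ i, (F i).IsSimple := fun i => by
    fin_cases i
    · exact hSs
    · exact isSimple_of_dim_le_one (A := E) hE1.le
  have hFcm : ∀ i, IsOfCMType (F i) := fun i => by
    fin_cases i
    · exact hScm
    · exact hEcm
  have hF12 : ∀ i, (F i).dim = 1 ∨ (F i).dim = 2 := fun i => by
    rw [hdimF i]; split_ifs <;> simp
  have hFniso : ∀ i i', i ≠ i' → ¬ IsIsogenous (F i) (F i') := by
    intro i i' hii' h
    have hd : (F i).dim = (F i').dim := dim_eq_of_isIsogenous_holds h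
    fin_cases i <;> fin_cases i'
    · exact hii' rfl
    · exact absurd hd (by simp [hdimF])
    · exact absurd hd (by simp [hdimF])
    · exact hii' rfl
  have h3 : ∀ i j k : Fin 2, i ≠ j → j ≠ k → i ≠ k → (F i).dim = 2 → (F j).dim = 2 → (F k).dim ≠ 2 := by
    intro i j k hij hjk hik
    exfalso
    fin_cases i <;> fin_cases j <;> fin_cases k <;> simp_all
  have h := mtRank_hodge_one_eq_and_isDivisorGenerated_of_isIsogenous_biproduct_cmCurves_cmSurfaces hFs hFcm hF12 hFniso h3 hcls hX hXB
  have hsum : ∑ i, (F i).dim = 3 := by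
    simp only [Fin.sum_univ_two, hdimF]
    decide
  rw [hsum] at h
  exact h

/-- **Two NON-isogenous simple CM surfaces × a CM elliptic curve: `t(S × S' × E) = 6`** — the all-CM cell of the dimension-`5` partition `{2,2,1}`
(`Hg = U_F × U_{F'} × U_k`, rank `5 = rdim`; two surface slots may even share their closure).
[cite: MoonenZarhin1999LowDim, §3 (3.1) and (3.9)] [cite: Gordon1999HodgeAVSurvey, 7.5 and 9.1] -/
theorem mtRank_hodge_one_eq_six_of_isIsogenous_cmSurfaces_prod_prod_cmCurve (hX : IsSmoothProjective n X.X) {S S' E : AbelianVariety ℂ}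
    (hSs : S.IsSimple) (hS2 : S.dim = 2) (hScm : IsOfCMType S) (hS's : S'.IsSimple) (hS'2 : S'.dim = 2) (hS'cm : IsOfCMType S')
    (hSS' : ¬ IsIsogenous S S') (hE1 : E.dim = 1) (hEcm : IsOfCMType E) (hXP : IsIsogenous X (S.prod (S'.prod E))) :
    haveI := BettiUniverse.finite hX 1
    (BettiUniverse.hodge exists_isReal_hodgeModel_holds hX 1).mtRank = 6 ∧ ∀ N : ℕ, IsDivisorGenerated (X.powSucc N) := by
  classical
  let F : Fin 3 → AbelianVariety ℂ := ![S, S', E]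
  have hF0 : F 0 = S := rfl
  have hF1 : F 1 = S' := rfl
  have hF2 : F 2 = E := rfl
  have hXB : IsIsogenous X (⨁ fun j => F (id j)) := hXP.trans (biproduct_three_isIsogenous_prod_prod F).symm'
  have hdimF : ∀ i, (F i).dim = if i = 2 then 1 else 2 := fun i => by
    fin_cases i
    · simpa [hF0] using hS2
    · simpa [hF1] using hS'2
    · simpa [hF2] using hE1
  have hFs : ∀ i, (F i).IsSimple := fun i => by
    fin_cases i
    · exact hSs
    · exact hS's
    · exact isSimple_of_dim_le_one (A := E) hE1.le
  have hFcm : ∀ i, IsOfCMType (F i) := fun i => by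
    fin_cases i
    · exact hScm
    · exact hS'cm
    · exact hEcm
  have hF12 : ∀ i, (F i).dim = 1 ∨ (F i).dim = 2 := fun i => by
    rw [hdimF i]; split_ifs <;> simp
  have hd2 : ∀ i, (F i).dim = 2 → i ≠ 2 := fun i hi h => by
    rw [hdimF i, if_pos h] at hi; omega
  have hFniso : ∀ i i', i ≠ i' → ¬ IsIsogenous (F i) (F i') := by
    intro i i' hii' h
    have hd : (F i).dim = (F i').dim := dim_eq_of_isIsogenous_holds h
    fin_cases i <;> fin_cases i'
    · exact hii' rfl
    · exact hSS' h
    · exact absurd hd (by simp [hdimF])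
    · exact hSS' h.symm'
    · exact hii' rfl
    · exact absurd hd (by simp [hdimF])
    · exact absurd hd (by simp [hdimF])
    · exact absurd hd (by simp [hdimF])
    · exact hii' rfl
  have h3 : ∀ i j k : Fin 3, i ≠ j → j ≠ k → i ≠ k → (F i).dim = 2 → (F j).dim = 2 → (F k).dim ≠ 2 := by
    intro i j k hij hjk hik hi hj hk
    have hi' := hd2 i hi
    have hj' := hd2 j hj
    have hk' := hd2 k hk
    fin_cases i <;> fin_cases j <;> fin_cases k <;> simp_all
  have h := mtRank_hodge_one_eq_and_isDivisorGenerated_of_isIsogenous_biproduct_cmCurves_cmSurfaces hFs hFcm hF12 hFniso h3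
    Function.surjective_id hX hXB
  have hsum : ∑ i, (F i).dim = 5 := by
    simp only [Fin.sum_univ_three, hdimF]
    decide
  rw [hsum] at h
  exact h

end Summit.HodgeConjecture.CorCM

end
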